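import Summits.CriticalPhenomena.Ising3DConformalLimit.Theorems.EnergyNotSigmaSquaredGapForcesFarMergingSandwichDefs
import Literature.Probability.LatticeModels.AizenmanWickSplice
import HarnessLib

/-!
# The double sandwich (stub `stub_doubleSandwich` of line `one-cluster-depletion-sandwich`,
# crux `GapForcesFarMerging`, item stmt-CriticalPhenomena-4468)

Finite-graph content, couplings `K ≥ 0` on a finite simple graph `G` (`WeightedCurrents.lean`:
`w = Current.eweight K`, `epairWeight K A B (n₁,n₂) = 1{∂n₁ = A}1{∂n₂ = B} w w`, `Z[A] = ecurrentSum K A`,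
`Z_{G∖T}[B] = ecurrentSumIn (offGraph G T) K B`, `⟨σ_B⟩_{Λ∖T} = Current.offRatio K T B`). We prove the
currency `DoubleSandwich` of the Defs module:

`∑ 1{∂n₁=ox}1{∂n₂=∅}1{∂n₃=ax'}1{∂n₄=∅} w⁴ 𝟙[C_{n₁+n₂}(o) ∩ C_{n₃+n₄}(a) = ∅]
   ≤ Z[∅]² · ∑ 1{∂n₁=ox}1{∂n₃=ax'} w w 𝟙[a ∉ C_{n₁+n₃}(o)]`,

i.e. `P^{ox,∅}⊗P^{ax',∅}[C_{n₁+n₂}(o) ∩ C_{n₃+n₄}(a) = ∅] ≤ P^{ox}⊗P^{ax'}[o ↮ a]`: the avoidance of two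
sourced currents dominates the avoidance of two independent duplicated clusters (the objects of
Aizenman–Duminil-Copin 2021, (3.13)).

## Proof

* (A) Lemma A.1 of Aizenman–Duminil-Copin 2021 (tree `Current.tsum_epairWeight_eq_tsum_mul_offRatio`, cluster
  of `o`, `F = 𝟙[a ∉ C_{n₁+n₃}(o)]`, sources `{a,x'}` of `n₃` removed): the right side equals
  `Z[∅]² ∑ 1{ox}1{∅} w w 𝟙[a ∉ X] ⟨σ_aσ_{x'}⟩_{Λ∖X}`, `X = C_{n₁+n₂}(o)`.
* (B) ONE-SET DEPLETION SANDWICH (`avoid_mul_sq_le`): for every vertex set `X`,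
  `∑ 1{∂n₃=ax'}1{∂n₄=∅} w w 𝟙[C_{n₃+n₄}(a) ∩ X = ∅] · Z_{G∖X}[∅]² ≤ Z[∅]² · Z_{G∖X}[ax'] Z_{G∖X}[∅]`.
  Freeze the duplicated cluster `T = C_{n₃+n₄}(a)` (tree `Current.tsum_pair_eq_sum_cluster`): the pair splits
  into an inside pair living in `T` and two free sourceless outside currents off `T`
  (`tsum_epairWeight_clusterEq_eq`: mass `= inside(T) · Z_{G∖T}[∅]²`); the same for the couplings cut at `X`
  (`cutCoupling K X`), whose inside masses agree for `T ∩ X = ∅` and whose outside factor is `Z_{G∖(X∪T)}[∅]²`;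
  compare with Griffiths' super-multiplicativity `Z_{G∖X}[∅] Z_{G∖T}[∅] ≤ Z[∅] Z_{G∖(X∪T)}[∅]`
  (Aizenman 1982 Lemma 9.3, tree `ecurrentSumIn_offGraph_empty_mul_le`).
* (C) Fubini over `(n₁,n₂)`, and `a ∈ C_{n₃+n₄}(a)`.

References: M. Aizenman, H. Duminil-Copin, Ann. of Math. 194 (2021), arXiv:1912.07973, §3 (3.13), App. A
Lemma A.1, Cor. A.2 [AizenmanDuminilCopinAnnals2021]; M. Aizenman, Comm. Math. Phys. 86 (1982), Lemma 9.3
[AizenmanCMP1982].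
-/

noncomputable section

namespace Summit.CriticalPhenomena.Ising3DConformalLimit.EnergyNotSigmaSquaredGapForcesFarMergingSandwich

namespace DoubleSandwichProof

open scoped symmDiff ENNReal
open Finset
open Literature.Probability.LatticeModels Literature.Probability.LatticeModels.Current

variable {V : Type*} [Fintype V] [DecidableEq V] {G : SimpleGraph V} [DecidableRel G.Adj]
  {K : G.edgeFinset → ℝ}

/-! ### Resolution of a sum by the value of a cluster -/

/-- Resolving a `tsum` by the value of a finite-set valued statistic:
`∑_x f(x) g(c(x)) = ∑_T (∑_x f(x) 𝟙[c(x) = T]) g(T)`. [folklore] -/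
theorem tsum_mul_apply_eq_sum {α : Type*} (f : α → ℝ≥0∞) (c : α → Finset V) (g : Finset V → ℝ≥0∞) :
    ∑' x, f x * g (c x) = ∑ T : Finset V, (∑' x, f x * (if c x = T then 1 else 0)) * g T := by
  have h : ∀ x, f x * g (c x) = ∑ T : Finset V, f x * (if c x = T then 1 else 0) * g T := by
    intro x
    rw [Finset.sum_eq_single (c x) (fun T _ hT => by rw [if_neg (Ne.symm hT), mul_zero, zero_mul])
      (fun h => absurd (Finset.mem_univ _) h), if_pos rfl, mul_one]
  rw [tsum_congr h, Summable.tsum_finsetSum (fun _ _ => ENNReal.summable)]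
  exact Finset.sum_congr rfl fun T _ => ENNReal.tsum_mul_right

/-! ### Freezing the duplicated cluster: the pair mass factorises -/

/-- **Factorisation at a frozen duplicated cluster.** For `K ≥ 0`, a vertex `a`, sources `A ⊆ T`:
`∑ 1{∂n₁=A}1{∂n₂=∅} w w 𝟙[C_{n₁+n₂}(a) = T] = inside(T) · Z_{G∖T}[∅]²`, where `inside(T)` is the mass of
the pairs `(m₁,m₂)` living in `T` with `C_{m₁+m₂}(a) = T`, `∂m₁ = A`, `∂m₂ = ∅`: both outside parts are free
sourceless currents off `T` (tree `Current.tsum_pair_eq_sum_cluster`). [cite: AizenmanDuminilCopinAnnals2021, arXiv:1912.07973 Appendix A.1, proof of Lemma A.1] -/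
theorem tsum_epairWeight_clusterEq_eq (hK : ∀ e, 0 ≤ K e) (a : V) {A T : Finset V} (hAT : A ⊆ T) :
    ∑' p : Current G × Current G, epairWeight K A ∅ p * (if (p.1 + p.2).cluster a = T then 1 else 0) =
      (∑' m : Current G × Current G,
        if (IsSupp (offGraph G Tᶜ) m.1 ∧ IsSupp (offGraph G Tᶜ) m.2 ∧ (m.1 + m.2).cluster a = T) ∧
            (m.1.sources = A ∧ m.2.sources = ∅) then m.1.eweight K * m.2.eweight K else 0) *
      ecurrentSumIn (offGraph G T) K ∅ ^ 2 := by
  classical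
  have h0 : (∑' p : Current G × Current G, epairWeight K A ∅ p *
      (if (p.1 + p.2).cluster a = T then 1 else 0)) =
      ∑' p : Current G × Current G, p.1.eweight K * p.2.eweight K *
        (fun p : Current G × Current G => (if p.1.sources = A then 1 else 0) *
          (if p.2.sources = ∅ then 1 else 0) *
          (if (p.1 + p.2).cluster a = T then (1 : ℝ≥0∞) else 0)) p :=
    tsum_congr fun p => epairWeight_mul_eq K A ∅ p _
  rw [h0, tsum_pair_eq_sum_cluster hK a, Finset.sum_eq_single_of_mem T (Finset.mem_univ T)]
  · -- the `T` term factorises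
    rw [sq, ecurrentSumIn, tsum_ite_mul_tsum_ite, tsum_ite_mul_tsum_ite]
    refine tsum_congr ?_
    rintro ⟨⟨m₁, m₂⟩, ⟨k₁, k₂⟩⟩
    dsimp only
    by_cases hin : IsSupp (offGraph G Tᶜ) m₁ ∧ IsSupp (offGraph G Tᶜ) m₂ ∧ (m₁ + m₂).cluster a = T
    · obtain ⟨hm₁, hm₂, hcl⟩ := hin
      by_cases hout : IsSupp (offGraph G T) k₁ ∧ IsSupp (offGraph G T) k₂
      · obtain ⟨hk₁, hk₂⟩ := hout
        have hcl' : (m₁ + k₁ + (m₂ + k₂)).cluster a = T := by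
          rw [add_add_add_comm]
          exact cluster_add_eq_of_isSupp (isSupp_add hm₁ hm₂) (isSupp_add hk₁ hk₂) hcl
        have hs₁ : (m₁ + k₁).sources = A ↔ m₁.sources = A ∧ k₁.sources = ∅ := by
          rw [sources_add_eq_iff_of_isSupp hm₁ hk₁ A, Finset.inter_eq_left.2 hAT,
            Finset.sdiff_eq_empty_iff_subset.2 hAT]
        have hs₂ : (m₂ + k₂).sources = ∅ ↔ m₂.sources = ∅ ∧ k₂.sources = ∅ := by
          rw [sources_add_eq_iff_of_isSupp hm₂ hk₂ ∅, Finset.empty_inter, Finset.empty_sdiff]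
        rw [if_pos ⟨hm₁, hm₂, hcl⟩, if_pos ⟨hk₁, hk₂⟩, if_pos hcl', mul_one]
        by_cases h₁ : m₁.sources = A ∧ k₁.sources = ∅
        · rw [if_pos (hs₁.2 h₁), one_mul]
          by_cases h₂ : m₂.sources = ∅ ∧ k₂.sources = ∅
          · rw [if_pos (hs₂.2 h₂), mul_one,
              if_pos ⟨⟨⟨hm₁, hm₂, hcl⟩, h₁.1, h₂.1⟩, ⟨hk₁, h₁.2⟩, ⟨hk₂, h₂.2⟩⟩]
          · rw [if_neg (fun h => h₂ (hs₂.1 h)), mul_zero, if_neg]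
            rintro ⟨⟨-, -, hs⟩, -, -, ht⟩
            exact h₂ ⟨hs, ht⟩
        · rw [if_neg (fun h => h₁ (hs₁.1 h)), zero_mul, mul_zero, if_neg]
          rintro ⟨⟨-, hs, -⟩, ⟨-, ht⟩, -⟩
          exact h₁ ⟨hs, ht⟩
      · rw [if_neg hout, mul_zero, zero_mul, if_neg]
        rintro ⟨-, ⟨h, -⟩, ⟨h', -⟩⟩
        exact hout ⟨h, h'⟩
    · rw [if_neg hin, zero_mul, zero_mul, if_neg]
      rintro ⟨⟨h, -⟩, -⟩
      exact hin h
  · -- the other values of the cluster do not contribute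
    intro B _ hBT
    refine ENNReal.tsum_eq_zero.2 fun q => ?_
    by_cases hin : IsSupp (offGraph G Bᶜ) q.1.1 ∧ IsSupp (offGraph G Bᶜ) q.1.2 ∧
        (q.1.1 + q.1.2).cluster a = B
    · by_cases hout : IsSupp (offGraph G B) q.2.1 ∧ IsSupp (offGraph G B) q.2.2
      · have hcl' : (q.1.1 + q.2.1 + (q.1.2 + q.2.2)).cluster a ≠ T := by
          rw [add_add_add_comm,
            cluster_add_eq_of_isSupp (isSupp_add hin.1 hin.2.1) (isSupp_add hout.1 hout.2) hin.2.2]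
          exact hBT
        simp only [if_neg hcl', mul_zero]
      · rw [if_neg hout, mul_zero, zero_mul]
    · rw [if_neg hin, zero_mul, zero_mul]

/-- For a pair source set `A = {a} ∆ {x'}` the frozen-cluster mass vanishes unless `A ⊆ T`
(`a ∈ C(a)` and `a ↔ x'` in `n₁`). [folklore] -/
theorem tsum_epairWeight_clusterEq_eq_zero (K : G.edgeFinset → ℝ) {a x' : V} {T : Finset V}
    (h : ¬ ({a} ∆ {x'} ⊆ T)) :
    ∑' p : Current G × Current G, epairWeight K ({a} ∆ {x'}) ∅ p *
      (if (p.1 + p.2).cluster a = T then 1 else 0) = 0 := by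
  refine ENNReal.tsum_eq_zero.2 fun p => ?_
  by_cases hT : (p.1 + p.2).cluster a = T
  · by_cases hs : p.1.sources = {a} ∆ {x'}
    · exfalso
      refine h fun v hv => ?_
      rw [← hT]
      rcases eq_or_eq_of_mem_symmDiff_singleton hv with rfl | rfl
      · exact mem_cluster_self _ _
      · exact cluster_mono (self_le_add_right p.1 p.2) _ (mem_cluster_of_sources_eq hs)
    · rw [epairWeight_eq_mul, if_neg hs, zero_mul, zero_mul]
  · rw [if_neg hT, mul_zero]

/-! ### Cutting the couplings at a set `X` disjoint from the frozen cluster -/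

/-- A current living in `T` does not see the couplings cut at a set `X` disjoint from `T`. [folklore] -/
theorem eweight_cutCoupling_of_isSupp_compl {X T : Finset V} (hXT : Disjoint X T) {m : Current G}
    (hm : IsSupp (offGraph G Tᶜ) m) : m.eweight (cutCoupling K X) = m.eweight K := by
  have hX : IsSupp (offGraph G X) m := by
    rw [isSupp_offGraph_iff']
    intro e hne v hv hvX
    exact Finset.disjoint_right.1 hXT ((isSupp_offGraph_compl_iff T m).1 hm e hne v hv) hvX
  unfold Current.eweight
  rw [wweight_cutCoupling, if_pos hX]

/-- The inside masses of `K` and of the couplings cut at `X` agree when `X ∩ T = ∅`. [folklore] -/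
theorem inside_cutCoupling_eq {X T : Finset V} (hXT : Disjoint X T) (a : V) (A : Finset V) :
    (∑' m : Current G × Current G,
        if (IsSupp (offGraph G Tᶜ) m.1 ∧ IsSupp (offGraph G Tᶜ) m.2 ∧ (m.1 + m.2).cluster a = T) ∧
            (m.1.sources = A ∧ m.2.sources = ∅) then
          m.1.eweight (cutCoupling K X) * m.2.eweight (cutCoupling K X) else 0) =
      ∑' m : Current G × Current G,
        if (IsSupp (offGraph G Tᶜ) m.1 ∧ IsSupp (offGraph G Tᶜ) m.2 ∧ (m.1 + m.2).cluster a = T) ∧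
            (m.1.sources = A ∧ m.2.sources = ∅) then m.1.eweight K * m.2.eweight K else 0 := by
  refine tsum_congr fun m => ?_
  split_ifs with h
  · rw [eweight_cutCoupling_of_isSupp_compl hXT h.1.1, eweight_cutCoupling_of_isSupp_compl hXT h.1.2.1]
  · rfl

/-- `Z_{(G∖T), K cut at X}[B] = Z_{G∖(X∪T)}[B]`. [folklore] -/
theorem ecurrentSumIn_offGraph_cutCoupling (X T B : Finset V) :
    ecurrentSumIn (offGraph G T) (cutCoupling K X) B = ecurrentSumIn (offGraph G (X ∪ T)) K B := by
  rw [ecurrentSumIn_offGraph_eq_cutCoupling (cutCoupling K X) T B, cutCoupling_cutCoupling,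
    ← ecurrentSumIn_offGraph_eq_cutCoupling]

/-- **The frozen cluster does not see deleted far-away edges** (pair version of the tree's
`Current.cmass_empty_mul_ecurrentSumIn_eq`): for `A ⊆ T`, `X ∩ T = ∅`,
`M_K[C(a) = T] · Z_{G∖(X∪T)}[∅]² = M_{K cut at X}[C(a) = T] · Z_{G∖T}[∅]²`. [cite: AizenmanCMP1982, Lemma 9.2] -/
theorem clusterEq_mul_sq_eq (hK : ∀ e, 0 ≤ K e) (a : V) {A X T : Finset V} (hAT : A ⊆ T)
    (hXT : Disjoint X T) :
    (∑' p : Current G × Current G, epairWeight K A ∅ p * (if (p.1 + p.2).cluster a = T then 1 else 0)) *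
        ecurrentSumIn (offGraph G (X ∪ T)) K ∅ ^ 2 =
      (∑' p : Current G × Current G, epairWeight (cutCoupling K X) A ∅ p *
          (if (p.1 + p.2).cluster a = T then 1 else 0)) *
        ecurrentSumIn (offGraph G T) K ∅ ^ 2 := by
  rw [tsum_epairWeight_clusterEq_eq hK a hAT, tsum_epairWeight_clusterEq_eq (cutCoupling_nonneg hK X) a hAT,
    inside_cutCoupling_eq hXT a A, ecurrentSumIn_offGraph_cutCoupling X T ∅]
  ring

/-! ### The one-set depletion sandwich -/

/-- One frozen cluster: `M_K[C(a) = T] · 𝟙[X ∩ T = ∅] Z_{G∖X}[∅]² ≤ Z[∅]² · M_{K cut at X}[C(a) = T]`, by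
`clusterEq_mul_sq_eq` and Griffiths' super-multiplicativity `Z_{G∖X}[∅] Z_{G∖T}[∅] ≤ Z[∅] Z_{G∖(X∪T)}[∅]`
(Aizenman 1982, Lemma 9.3; tree `ecurrentSumIn_offGraph_empty_mul_le`). [cite: AizenmanCMP1982, Lemma 9.3] -/
theorem clusterEq_term_le (hK : ∀ e, 0 ≤ K e) (a x' : V) (X T : Finset V) :
    (∑' p : Current G × Current G, epairWeight K ({a} ∆ {x'}) ∅ p *
        (if (p.1 + p.2).cluster a = T then 1 else 0)) *
      ((if Disjoint X T then 1 else 0) * ecurrentSumIn (offGraph G X) K ∅ ^ 2) ≤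
    ecurrentSum K ∅ ^ 2 *
      ∑' p : Current G × Current G, epairWeight (cutCoupling K X) ({a} ∆ {x'}) ∅ p *
        (if (p.1 + p.2).cluster a = T then 1 else 0) := by
  by_cases hXT : Disjoint X T
  swap
  · rw [if_neg hXT, zero_mul, mul_zero]; exact bot_le
  by_cases hAT : {a} ∆ {x'} ⊆ T
  swap
  · rw [tsum_epairWeight_clusterEq_eq_zero K hAT, zero_mul]; exact bot_le
  rw [if_pos hXT, one_mul]
  set F := ∑' p : Current G × Current G, epairWeight K ({a} ∆ {x'}) ∅ p *
    (if (p.1 + p.2).cluster a = T then 1 else 0)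
  set F' := ∑' p : Current G × Current G, epairWeight (cutCoupling K X) ({a} ∆ {x'}) ∅ p *
    (if (p.1 + p.2).cluster a = T then 1 else 0)
  set ZX := ecurrentSumIn (offGraph G X) K ∅
  set ZT := ecurrentSumIn (offGraph G T) K ∅
  set ZXT := ecurrentSumIn (offGraph G (X ∪ T)) K ∅
  set Z₀ := ecurrentSum K (∅ : Finset V)
  have key : F * ZXT ^ 2 = F' * ZT ^ 2 := clusterEq_mul_sq_eq hK a hAT hXT
  have gks : ZX * ZT ≤ Z₀ * ZXT := ecurrentSumIn_offGraph_empty_mul_le hK X T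
  have h0 : ZXT ^ 2 ≠ 0 := pow_ne_zero _ (ecurrentSumIn_empty_ne_zero _ K)
  have htop : ZXT ^ 2 ≠ ∞ := ENNReal.pow_ne_top (ecurrentSumIn_ne_top _ hK ∅)
  rw [← ENNReal.mul_le_mul_iff_left h0 htop]
  calc F * ZX ^ 2 * ZXT ^ 2 = F * ZXT ^ 2 * ZX ^ 2 := by ring
    _ = F' * ZT ^ 2 * ZX ^ 2 := by rw [key]
    _ = F' * ((ZX * ZT) * (ZX * ZT)) := by ring
    _ ≤ F' * ((Z₀ * ZXT) * (Z₀ * ZXT)) := mul_le_mul' le_rfl (mul_le_mul' gks gks)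
    _ = Z₀ ^ 2 * F' * ZXT ^ 2 := by ring

/-- **One-set depletion sandwich** (upper half), current-sum form: for `K ≥ 0`, vertices `a, x'` and ANY
vertex set `X`,
`∑ 1{∂n₁=ax'}1{∂n₂=∅} w w 𝟙[C_{n₁+n₂}(a) ∩ X = ∅] · Z_{G∖X}[∅]² ≤ Z[∅]² · Z_{G∖X}[ax'] · Z_{G∖X}[∅]`,
i.e. `P^{ax',∅}[C_{n₁+n₂}(a) ∩ X = ∅] ≤ (⟨σ_aσ_{x'}⟩_{Λ∖X}/⟨σ_aσ_{x'}⟩_Λ) · Z[∅]/Z_{G∖X}[∅]` — summing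
`clusterEq_term_le` over the value `T` of the frozen cluster (both sides resolved by `T`, the right one for the
couplings `cutCoupling K X`). [cite: AizenmanCMP1982, Lemma 9.3] -/
theorem avoid_mul_sq_le (hK : ∀ e, 0 ≤ K e) (a x' : V) (X : Finset V) :
    (∑' p : Current G × Current G, epairWeight K ({a} ∆ {x'}) ∅ p *
        (if Disjoint X ((p.1 + p.2).cluster a) then 1 else 0)) *
      ecurrentSumIn (offGraph G X) K ∅ ^ 2 ≤
    ecurrentSum K ∅ ^ 2 *
      (ecurrentSumIn (offGraph G X) K ({a} ∆ {x'}) * ecurrentSumIn (offGraph G X) K ∅) := by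
  have h1 := tsum_mul_apply_eq_sum (fun p : Current G × Current G => epairWeight K ({a} ∆ {x'}) ∅ p)
    (fun p => (p.1 + p.2).cluster a)
    (fun T => (if Disjoint X T then (1 : ℝ≥0∞) else 0) * ecurrentSumIn (offGraph G X) K ∅ ^ 2)
  beta_reduce at h1
  have h3 := tsum_mul_apply_eq_sum
    (fun p : Current G × Current G => epairWeight (cutCoupling K X) ({a} ∆ {x'}) ∅ p)
    (fun p => (p.1 + p.2).cluster a) (fun _ => (1 : ℝ≥0∞))
  simp only [mul_one] at h3
  have hR : ecurrentSumIn (offGraph G X) K ({a} ∆ {x'}) * ecurrentSumIn (offGraph G X) K ∅ =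
      ∑ T : Finset V, ∑' p : Current G × Current G, epairWeight (cutCoupling K X) ({a} ∆ {x'}) ∅ p *
        (if (p.1 + p.2).cluster a = T then 1 else 0) := by
    rw [ecurrentSumIn_offGraph_eq_cutCoupling K X ({a} ∆ {x'}), ecurrentSumIn_offGraph_eq_cutCoupling K X ∅,
      ← tsum_epairWeight, h3]
  calc (∑' p : Current G × Current G, epairWeight K ({a} ∆ {x'}) ∅ p *
          (if Disjoint X ((p.1 + p.2).cluster a) then 1 else 0)) * ecurrentSumIn (offGraph G X) K ∅ ^ 2
      = ∑ T : Finset V, (∑' p : Current G × Current G, epairWeight K ({a} ∆ {x'}) ∅ p *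
          (if (p.1 + p.2).cluster a = T then 1 else 0)) *
          ((if Disjoint X T then 1 else 0) * ecurrentSumIn (offGraph G X) K ∅ ^ 2) := by
        rw [← ENNReal.tsum_mul_right]
        simp only [mul_assoc]
        exact h1
    _ ≤ ∑ T : Finset V, ecurrentSum K ∅ ^ 2 *
          ∑' p : Current G × Current G, epairWeight (cutCoupling K X) ({a} ∆ {x'}) ∅ p *
            (if (p.1 + p.2).cluster a = T then 1 else 0) :=
        Finset.sum_le_sum fun T _ => clusterEq_term_le hK a x' X T
    _ = ecurrentSum K ∅ ^ 2 *
          (ecurrentSumIn (offGraph G X) K ({a} ∆ {x'}) * ecurrentSumIn (offGraph G X) K ∅) := by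
        rw [← Finset.mul_sum, hR]

/-- The normalised form of the one-set sandwich: `∑ 1{ax'}1{∅} w w 𝟙[C_{n₁+n₂}(a) ∩ X = ∅]
≤ ⟨σ_aσ_{x'}⟩_{Λ∖X} · Z[∅]²` (`⟨σ_B⟩_{Λ∖X} = Current.offRatio K X B`). [cite: AizenmanCMP1982, Lemma 9.3] -/
theorem avoid_le_offRatio_mul (hK : ∀ e, 0 ≤ K e) (a x' : V) (X : Finset V) :
    ∑' p : Current G × Current G, epairWeight K ({a} ∆ {x'}) ∅ p *
        (if Disjoint X ((p.1 + p.2).cluster a) then 1 else 0) ≤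
      offRatio K X ({a} ∆ {x'}) * ecurrentSum K ∅ ^ 2 := by
  have h0 : ecurrentSumIn (offGraph G X) K ∅ ≠ 0 := ecurrentSumIn_empty_ne_zero _ K
  have htop : ecurrentSumIn (offGraph G X) K ∅ ≠ ∞ := ecurrentSumIn_ne_top _ hK ∅
  have h := avoid_mul_sq_le hK a x' X
  rw [sq (ecurrentSumIn (offGraph G X) K ∅), ← mul_assoc, ← mul_assoc,
    ENNReal.mul_le_mul_iff_left h0 htop] at h
  unfold offRatio
  calc ∑' p : Current G × Current G, epairWeight K ({a} ∆ {x'}) ∅ p *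
        (if Disjoint X ((p.1 + p.2).cluster a) then 1 else 0)
      ≤ ecurrentSum K ∅ ^ 2 * ecurrentSumIn (offGraph G X) K ({a} ∆ {x'}) / ecurrentSumIn (offGraph G X) K ∅ :=
        (ENNReal.le_div_iff_mul_le (Or.inl h0) (Or.inl htop)).2 h
    _ = ecurrentSumIn (offGraph G X) K ({a} ∆ {x'}) / ecurrentSumIn (offGraph G X) K ∅ *
          ecurrentSum K ∅ ^ 2 := by
        rw [mul_div_assoc, mul_comm]

/-- The inner bound of the double sandwich at a frozen first pair, `X = C_{n₁+n₂}(o)`: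
`∑ 1{ax'}1{∅} w w 𝟙[X ∩ C_{n₃+n₄}(a) = ∅] ≤ 𝟙[a ∉ X] · ⟨σ_aσ_{x'}⟩_{Λ∖X} · Z[∅]²` (`a ∈ C_{n₃+n₄}(a)`).
[cite: AizenmanCMP1982, Lemma 9.3] -/
theorem inner_le (hK : ∀ e, 0 ≤ K e) (a x' : V) (X : Finset V) :
    ∑' p : Current G × Current G, epairWeight K ({a} ∆ {x'}) ∅ p *
        (if Disjoint X ((p.1 + p.2).cluster a) then 1 else 0) ≤
      (if a ∉ X then 1 else 0) * offRatio K X ({a} ∆ {x'}) * ecurrentSum K ∅ ^ 2 := by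
  by_cases ha : a ∈ X
  · rw [if_neg (fun h => h ha), zero_mul, zero_mul]
    refine le_of_eq (ENNReal.tsum_eq_zero.2 fun p => ?_)
    rw [if_neg (fun h => Finset.disjoint_left.1 h ha (mem_cluster_self _ a)), mul_zero]
  · rw [if_pos ha, one_mul]
    exact avoid_le_offRatio_mul hK a x' X

/-! ### The double sandwich on a finite graph -/

/-- **Double sandwich**, finite graph, couplings `K ≥ 0`, current-sum form:
`∑ 1{∂n₁=ox}1{∂n₂=∅}1{∂n₃=ax'}1{∂n₄=∅} w⁴ 𝟙[C_{n₁+n₂}(o) ∩ C_{n₃+n₄}(a) = ∅]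
 ≤ Z[∅]² · ∑ 1{∂n₁=ox}1{∂n₃=ax'} w w 𝟙[a ∉ C_{n₁+n₃}(o)]`: Lemma A.1 of Aizenman–Duminil-Copin 2021 on
the right (tree `Current.tsum_epairWeight_eq_tsum_mul_offRatio`), the one-set sandwich `inner_le` inside
the sum over `(n₁,n₂)`. [cite: AizenmanDuminilCopinAnnals2021, arXiv:1912.07973 §3 eq. (3.13) and Appendix A.1, Lemma A.1] -/
theorem doubleSandwich_graph (hK : ∀ e, 0 ≤ K e) (o x a x' : V) :
    (∑' q : (Current G × Current G) × (Current G × Current G),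
        epairWeight K ({o} ∆ {x}) ∅ q.1 * epairWeight K ({a} ∆ {x'}) ∅ q.2 *
          (if Disjoint ((q.1.1 + q.1.2).cluster o) ((q.2.1 + q.2.2).cluster a) then 1 else 0)) ≤
      ecurrentSum K ∅ ^ 2 *
        ∑' p : Current G × Current G, epairWeight K ({o} ∆ {x}) ({a} ∆ {x'}) p *
          (if a ∉ (p.1 + p.2).cluster o then 1 else 0) := by
  -- (A) Lemma A.1 for the cluster of `o`, `F = 𝟙[a ∉ C_{n₁+n₃}(o)]`
  have hloc : ∀ n₁ n₂ n₂' : Current G,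
      (∀ e : G.edgeFinset, ¬ EdgeOff ((n₁ + n₂).cluster o) (e : Sym2 V) → n₂' e = n₂ e) →
      (if a ∉ (n₁ + n₂').cluster o then (1 : ℝ≥0∞) else 0) = if a ∉ (n₁ + n₂).cluster o then 1 else 0 :=
    fun n₁ n₂ n₂' h => by rw [cluster_add_congr_right h]
  have hvan : ∀ n₁ n₂ : Current G, n₁.sources = {o} ∆ {x} → n₂.sources = {a} ∆ {x'} →
      (if a ∉ (n₁ + n₂).cluster o then (1 : ℝ≥0∞) else 0) ≠ 0 →
      Disjoint ((n₁ + n₂).cluster o) ({a} ∆ {x'}) := by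
    intro n₁ n₂ _ h₂ hne
    have ha : a ∉ (n₁ + n₂).cluster o := fun h => hne (if_neg (not_not_intro h))
    rw [symmDiff_comm] at h₂ ⊢
    exact disjoint_cluster_of_sources_eq_right h₂ ha
  have hA := tsum_epairWeight_eq_tsum_mul_offRatio hK o ({o} ∆ {x}) ({a} ∆ {x'})
    (fun p => if a ∉ (p.1 + p.2).cluster o then (1 : ℝ≥0∞) else 0) hloc hvan
  beta_reduce at hA
  -- (C) Fubini over the first pair and the inner bound
  calc (∑' q : (Current G × Current G) × (Current G × Current G),
        epairWeight K ({o} ∆ {x}) ∅ q.1 * epairWeight K ({a} ∆ {x'}) ∅ q.2 *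
          (if Disjoint ((q.1.1 + q.1.2).cluster o) ((q.2.1 + q.2.2).cluster a) then 1 else 0))
      = ∑' p : Current G × Current G, epairWeight K ({o} ∆ {x}) ∅ p *
          ∑' p' : Current G × Current G, epairWeight K ({a} ∆ {x'}) ∅ p' *
            (if Disjoint ((p.1 + p.2).cluster o) ((p'.1 + p'.2).cluster a) then 1 else 0) := by
        rw [ENNReal.tsum_prod']
        refine tsum_congr fun p => ?_
        rw [← ENNReal.tsum_mul_left]
        refine tsum_congr fun p' => ?_
        ring
    _ ≤ ∑' p : Current G × Current G, epairWeight K ({o} ∆ {x}) ∅ p *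
          ((if a ∉ (p.1 + p.2).cluster o then 1 else 0) * offRatio K ((p.1 + p.2).cluster o) ({a} ∆ {x'}) *
            ecurrentSum K ∅ ^ 2) :=
        ENNReal.tsum_le_tsum fun p => mul_le_mul' le_rfl (inner_le hK a x' _)
    _ = (∑' p : Current G × Current G, epairWeight K ({o} ∆ {x}) ∅ p *
          ((if a ∉ (p.1 + p.2).cluster o then 1 else 0) * offRatio K ((p.1 + p.2).cluster o) ({a} ∆ {x'}))) *
          ecurrentSum K ∅ ^ 2 := by
        rw [← ENNReal.tsum_mul_right]
        refine tsum_congr fun p => ?_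
        ring
    _ = (∑' p : Current G × Current G, epairWeight K ({o} ∆ {x}) ({a} ∆ {x'}) p *
          (if a ∉ (p.1 + p.2).cluster o then 1 else 0)) * ecurrentSum K ∅ ^ 2 := by
        rw [← hA]
    _ = ecurrentSum K ∅ ^ 2 * ∑' p : Current G × Current G, epairWeight K ({o} ∆ {x}) ({a} ∆ {x'}) p *
          (if a ∉ (p.1 + p.2).cluster o then 1 else 0) := mul_comm _ _

end DoubleSandwichProof

open Summit.CriticalPhenomena.Ising3DConformalLimit.GapForcesFarMergingSandwich
open Summit.CriticalPhenomena.Ising3DConformalLimit.Theses.EnergyNotSigmaSquared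

/-- **DOUBLE SANDWICH** (registered stub `stub_doubleSandwich` of the line `one-cluster-depletion-sandwich`):
for every finite graph, couplings `K ≥ 0` and vertices `o x a x'`,
`∑ 1{∂n₁=ox}1{∂n₂=∅}1{∂n₃=ax'}1{∂n₄=∅} w⁴ 𝟙[C_{n₁+n₂}(o) ∩ C_{n₃+n₄}(a) = ∅]
 ≤ Z[∅]² · ∑ 1{∂n₁=ox}1{∂n₃=ax'} w w 𝟙[a ∉ C_{n₁+n₃}(o)]`
(`DoubleSandwichProof.doubleSandwich_graph`). [cite: AizenmanDuminilCopinAnnals2021, arXiv:1912.07973 §3 eq. (3.13) and Appendix A.1, Lemma A.1] -/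
theorem stub_doubleSandwich : DoubleSandwich := by
  intro V _ _ Γ _ K hK o x a x'
  exact DoubleSandwichProof.doubleSandwich_graph hK o x a x'

end Summit.CriticalPhenomena.Ising3DConformalLimit.EnergyNotSigmaSquaredGapForcesFarMergingSandwich

end
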